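import Summits.QuantumFields.BalabanUV.Beta.GAN24.CombLegRowsOfWindows
import Summits.QuantumFields.BalabanUV.Beta.GAN24.CombRelSourceHalfCharge
import Summits.QuantumFields.BalabanUV.Beta.GAN24.LegLetterWindowRows
import Summits.QuantumFields.BalabanUV.Beta.GAN24.HalfMemberSlavedDivergenceDrift
import Summits.QuantumFields.BalabanUV.Beta.GAN24.TransportMarginal
import Summits.QuantumFields.BalabanUV.Beta.GAN24.TaylorTrilinear

/-!
# `BalabanUV.Beta.GAN24.CombLegRowsOfNaturalWindows` — binder row G-an2-4 ∕ (CONV-C), TRANSFER-III (the (α-0) chain at row D1's literal of record (III′)), row L11 (Q-L):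
# **THE JUNCTION — THE FOUR (Q-L) ROWS `hL₁ hL₂ hL₁′ hL₂′` OF THE COMB-CHART `ε`-MEMBER AT `d = 3` FROM THE THREE NATURAL-WINDOW THEOREMS (AS HYPOTHESES, IN THE OWNER's
# (III′) SHAPES), THE SOURCE LETTER ROWS, AND THE SLAVED SLOT-DIVERGENCE ROWS — EVERY RATE AND THE LENGTH CHOSEN HERE** — MY W3 `CombLegRowsOfWindows` with `GoodL ∕ GoodLS ∕
# GoodLD :≡` the window's five slot rows at `δ ∕ δS ∕ δD`, its five window binders DISCHARGED INTO the hypotheses `HW1 ∕ HWs ∕ HWΔ` displayed in EXACTLY the quantifier shape of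
# the OWNER gan24-p1 g47's eighth ∕ ninth words `CombNaturalWindowH1.h1_window_of_combChart` ∕ `CombNaturalWindowShort.short_windows_of_combChart` (staged, INTENT-8∕-9, at the
# pin `c := cE₂`) and of a (III′) twin of his part 12 `NaturalWindowDrift.drift_windows_of_dressed_comb` (NOT yet typed — the root quantifier dropped, as in words 8∕9), (HS)(HS′) READ
# from the two raw letter rows of road-P2's (F1) dressed source `b̃′♮` (`Hb ∕ Hbd`, displayed — their (III′) supplier is the S′-campaign), (Hx0) DISCHARGED (leaf-01 g80's `CombRelSourceHalfCharge.locStencil₂_unitS₂_T2RecOf_comb` at level 0 — v1.1: the ONE home of that statement; v1 read W2 §0's copy),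
# (HSL)(HSL′)(HxL0) by MY generic `WindowSlotRows.exists_windowRows_of_locStencil₂`, (H3)∕(H3d) READ from the slaved slot-divergence rows `Hh₁ Hh₂ Hh₁d Hh₂d` of the members by MY
# generic `LegLetterWindowRows.exists_windowRows_legLetter_of_divRows` over W2's class memberships — the (III′) twin of MY (E) t1 `WrecAtEvenHalfRowsOfNaturalWindows` CUT AT THE
# (Q-L) ROWS (no capstone: the consumer at (III′) is MY (C-6)∕(C-6d) `CombHalfMemberCell(Drift)OfDivergences` with `Z l := y′_l`, junction probe rc 0)
# (G-an2-4 CRUX TEAM (2), leaf prover `b2b-balaban-gan24-formalise-leaf-03`, gen 81; FILE W4; the OWNER's W-17 l.66387 ∕ INTENT-8∕-9 l.66555 «what remains of L11–L13 at (III′) is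
# gan24-formalise-leaf-03 g81's JUNCTION»; no existing file touched)

NOT IN PRINT; OUR BOOKKEEPING ([folklore] composition BY NAME + the rate ∕ length arithmetic of MY (E) t1, token for token; 0 `def`, 0 cited facts, 0 `def … : Prop`, 0 sorry).
HONEST FRAMING (cell contract, verbatim): «discharging `BetaPertH` makes Bałaban's UV stability UNCONDITIONAL — a real constructive-QFT result; it is NOT the continuum limit and
NOT the Clay problem.»  HONEST DEPENDENCY (verbatim): «continuum YM on T⁴ ⇐ BetaPertH ∧ nine spine estimates (0/9 proved); BetaPertH ⇐ (D1) ∧ (D4) ∧ CAP+tail; G-an2-4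
gates asym, D1 and NE2/3/4.»

WHAT (`d = 3`, `Lc ≥ 1` via `[NeZero Lc]`, ANY `tabs : SymTables 3 Lc` with off-diagonal border `hBff hBmm`, every `cE cVH cΛ cE₂ cB Tc`, every `ε` with `ε·ε = 1`;
`y′_n := ½ • (T̃′♮_n + ε • P T̃′♮_n)`, `T̃′_n := T2RecOf 3 Lc (GcombSh Lc) (SpureCombOf tabs cE cVH cΛ) tabs.M cE₂ cB Tc tabs.vh₂S tabs.mixFF n`, legs `G′♮_m := unitK_m (GcombSh Lc m)`):
**`exists_legRows_halfMember_comb_three_of_naturalWindows`** — `∃ δ CL c ϑ, 0 < δ ∧ 0 ≤ c ∧ 0 < ϑ < 1 ∧ (∀ l, hL₁ (y′_l) CL δ) ∧ (∀ l, hL₂ (y′_l) CL δ) ∧ (∀ l, hL₁′ (c·ϑ^l) δ) ∧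
(∀ l, hL₂′ (c·ϑ^l) δ)` (the four rows spelled as MY (C-6d) `comb_cellDrift_rows_of_divergence_rows` spells `hL₁ hL₂ hL₁' hL₂'` at `Z l := y′_l`, ONE rate) from EXACTLY:
`HW1` (the k₀-window: `∃ δ₁ > 0 ∀ δ ≤ δ₁ ∃ kmin ∀ k ≥ kmin ∃ θ < 1, Cg ∀ n W C g, bounded → LocStencil₂ W C δ → five rows (g, δ) → LocStencil₂ (T^{(k+1)} W) (θC + Cg·g) δ` on the
chains `legChain (fun _ ↦ −(cE₂·Lc^{2(3+1)}·(Lc^{3+1})⁻¹)) (fun m ↦ G′♮_m) Lc n (k+1) (bsumPow …)`), `HWs` (the short windows, `∃ κ₁ > 0 ∀ δS δ … ∀ k₀ ∃ A ≥ 1, B ∀ p q W C g, q < k₀ → …`),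
`HWΔ` (the kernel-drift windows, `∃ κΔ > 0, ν < 1 ∀ δ δD … ∀ k₀ ∃ AΔ BΔ ∀ l q W C g, q < k₀ → … → LocStencil₂ (ΔT W) ((AΔC + BΔg)ν^l) δD`), the source letter rows `Hb`
(`LocStencil₂ b̃′♮_n Cb δ6`, all `n`) and `Hbd` (`LocStencil₂ (b̃′♮_{l+1} − b̃′♮_l) (cb·θb^l) δ6`), the slaved slot-divergence rows of the members `Hh₁ Hh₂` (`σ₁ σ₂`, one rate `δ₃`) and
of their drifts `Hh₁d Hh₂d` (`σ₁d·ν₃^n`, `σ₂d·ν₃^n`).  THE ORDER (t1's, the OWNER g38's RATE-ORDER INFO honoured): `δ₁, κ₁, (κΔ, ν_Δ)` and the letters' `(δ6, δ₃)` first;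
`δ7 := min(δ6, δz)` (`δz` = the level-0 member's own rate, leaf-01's `locStencil₂_unitS₂_T2RecOf_comb`); `δS := δ7∕3`; `δ := min(δ₁, δS, κ₁∕(18(d+1)), δS·Lc∕(108(d+1)), δ₃∕3)`; `δD := min(δ, κΔ∕(18(d+1)), δ·Lc∕(108(d+1)))`;
`k₀ := max(kmin(δ), kmin(δD)) + 1`; then the constants; `ν := max(ν_Δ, θb, ν₃)`; the four rows are delivered at `δD`.
READING (zero weight).  `HW1 ∕ HWs` are the eighth ∕ ninth words' conclusions at `c := cE₂` VERBATIM (a two-line successor discharges them BY NAME under `|cE₂| ≤ Lc^{2(3+1)}` once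
those words are ✓ + built); `HWΔ` awaits a (III′) part-12 twin; `Hb ∕ Hbd` await the (III′) source-row socket; `Hh₁ … Hh₂d` are leaf-01 g80's (b1)-at-(III′) chain's currency.
Asserts NO shape of Bałaban's tables beyond the displayed rows and NO value of any charge; NOTHING of (H1♮) ∕ (H1w) ∕ (H1Δw) ∕ (C) ∕ `hcell ∕ hcelld` discharged; NOT «(Q-L) closed»;
the (III′) campaign is NOT asked (an2 W-4); NEVER «G-an2-4 closed» as (CONV-C); NOT D1, NOT `BetaPertH`, NOT continuum, NOT Clay; not in print.
Unit `b2b-balaban-gan24-formalise-leaf-03` (gen 81), 2026-08-25.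
-/

noncomputable section

open Finset
open scoped BigOperators
open Literature.MathematicalPhysics.QuantumFieldTheory
open Literature.MathematicalPhysics.QuantumFieldTheory.Balaban1983to89
open Literature.MathematicalPhysics.QuantumFieldTheory.Balaban1983to89.Beta
open B6BondElimination (unitVec)
open B12Sec2to5 (l1 l1_nonneg)
open ExpKernelCalculus (MKer Site shiftK)
open OneStepResolventKernel (Fib)
open SecondOrderResponse (W2SymOfK)
open KernelWard (divV)
open BalabanCompositeJets (LocStencil₂ LocStencil₂.nonneg LocStencil₂.mono)
open BalabanStepJetsSucc (mmRead)
open BalabanStepW2 (K3OfK M2Of)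
open Summit.QuantumFields.BalabanUV.Beta.TameKernelCalculus (trK)
open Summit.QuantumFields.BalabanUV.Beta.BorderedHessian (sgnK)
open Summit.QuantumFields.BalabanUV.Beta.HessKerDressedUnits (unitK unitS)
open Summit.QuantumFields.BalabanUV.Beta.SecondOrderUnits (unitM unitS₂ unitM₂)
open Summit.QuantumFields.BalabanUV.Beta.SpineRooted (T2RecOf)
open Summit.QuantumFields.BalabanUV.Beta.SymmetrisedStepJets (SymTables)
open Summit.QuantumFields.BalabanUV.Beta.CombChartStepJets (GcombSh SpureCombOf)
open Summit.QuantumFields.BalabanUV.Beta.GAN24.CombesThomas (sfStep smStep)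
open Summit.QuantumFields.BalabanUV.Beta.GAN24.BiStencilZeroMode (zmode)
open Summit.QuantumFields.BalabanUV.Beta.GAN24.Lin4LegTower (rdiv)
open Summit.QuantumFields.BalabanUV.Beta.GAN24.Lin4LegTowerUnroll (legStepB bsumPow legChain)
open Summit.QuantumFields.BalabanUV.Beta.GAN24.TaylorTrilinear (nonneg_of_abs_le_mul_exp)
open Summit.QuantumFields.BalabanUV.Beta.GAN24.TransportMarginal (locStencil₂_weaken)
open Summit.QuantumFields.BalabanUV.Beta.GAN24.BiTableParityHalves (locStencil₂_half)
open Summit.QuantumFields.BalabanUV.Beta.GAN24.HalfMemberSlavedDivergenceDrift (half_sub)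
open Summit.QuantumFields.BalabanUV.Beta.GAN24.WSlotT2OfPieces (locStencil₂_mono)
open Summit.QuantumFields.BalabanUV.Beta.GAN24.LegFirstWindowRows (locStencil₂_rdiv)
open Summit.QuantumFields.BalabanUV.Beta.GAN24.LegDriftRowsOfLegChain (rdiv_comp_sub)
open Summit.QuantumFields.BalabanUV.Beta.GAN24.WindowSlotRows (exists_windowRows_of_locStencil₂ windowRows_weaken)
open Summit.QuantumFields.BalabanUV.Beta.GAN24.LegLetterWindowRows (exists_windowRows_legLetter_of_divRows)
open Summit.QuantumFields.BalabanUV.Beta.GAN24.CombRelSourceHalfCharge (locStencil₂_unitS₂_T2RecOf_comb)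
open Summit.QuantumFields.BalabanUV.Beta.GAN24.CombLegSourceRuledClass (halfMember_comb_legLetter_mem halfMember_comb_legDrift_mem)
open Summit.QuantumFields.BalabanUV.Beta.GAN24.CombLegRowsOfWindows (legRows_halfMember_comb_three_of_windows legDriftRows_halfMember_comb_three_of_windows)

namespace Summit.QuantumFields.BalabanUV.Beta.GAN24.CombLegRowsOfNaturalWindows

variable {Lc : ℕ} [NeZero Lc]

/-- [folklore] `min`-arithmetic: `x ≤ a∕b` with `0 < b` gives `b·x ≤ a` (`private`, as in MY (E) t1 ∕ t2 — a public twin would bounce `dedup.landed`). -/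
private theorem mul_le_of_le_div' {x a b : ℝ} (hb : 0 < b) (h : x ≤ a / b) : b * x ≤ a := by
  rw [mul_comm]; exact (le_div_iff₀ hb).mp h

/-- NOT IN PRINT; OUR BOOKKEEPING.  **THE JUNCTION: THE FOUR (Q-L) ROWS OF THE COMB-CHART `ε`-MEMBER AT `d = 3` FROM THE THREE NATURAL-WINDOW THEOREMS (AS HYPOTHESES, THE
OWNER's (III′) SHAPES AT `c := cE₂`), THE SOURCE LETTER ROWS, AND THE SLAVED SLOT-DIVERGENCE ROWS OF THE MEMBERS AND THEIR DRIFTS** — MY W3 with `GoodL ∕ GoodLS ∕ GoodLD :≡`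
the five slot rows at `δ ∕ δS ∕ δD`, (HS)(HS′) from `Hb ∕ Hbd` (the OWNER's `locStencil₂_half` ⨾ MY `locStencil₂_rdiv`; leaf-01's `half_sub` ⨾ MY `rdiv_comp_sub`), (Hx0) from leaf-01's `locStencil₂_unitS₂_T2RecOf_comb` at
level `0`, (HSL)(HSL′)(HxL0) by `exists_windowRows_of_locStencil₂`, (H3)∕(H3d) from `Hh₁ Hh₂ Hh₁d Hh₂d` by `exists_windowRows_legLetter_of_divRows` over W2's memberships, the rates
and the length chosen in the order of the file docstring; all four rows delivered at the drift rate. -/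
theorem exists_legRows_halfMember_comb_three_of_naturalWindows (tabs : SymTables 3 Lc) (cE cVH cΛ cE₂ cB : ℝ)
    (Tc : Fin 4 → Fin 4 → Fin 4 → Fin 4 → ℝ)
    (hBff : ∀ κ u κ' u' x z (α β : Fin (3 + 1)), tabs.vh₂S κ u κ' u' x z (Sum.inl α) (Sum.inl β) = 0)
    (hBmm : ∀ κ u κ' u' x z (μ ν : Fin (3 + 1)), tabs.vh₂S κ u κ' u' x z (Sum.inr μ) (Sum.inr ν) = 0) {ε : ℝ} (hε : ε * ε = 1)
    (HW1 : ∃ δ₁ : ℝ, 0 < δ₁ ∧ ∀ δ : ℝ, 0 < δ → δ ≤ δ₁ → ∃ kmin : ℕ, ∀ k : ℕ, kmin ≤ k →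
      ∃ θ Cg : ℝ, 0 ≤ θ ∧ θ < 1 ∧ 0 ≤ Cg ∧
        ∀ (n : ℕ) (W : (Fin (3 + 1) → (Fin (3 + 1) → ℤ) → Fin (3 + 1) → (Fin (3 + 1) → ℤ) → MKer (3 + 1) (Fib 3))) (C g : ℝ),
          (∃ B : ℝ, ∀ κ u κ' u' x z a b, |W κ u κ' u' x z a b| ≤ B) → LocStencil₂ W C δ →
          (∀ (κ₁ : Fin (3 + 1)) (v : Site (3 + 1)) (κ₂ : Fin (3 + 1)) (x p : Site (3 + 1)) (f b : Fib 3),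
              |∑' v', W κ₁ v κ₂ v' x p f b| ≤ g * Real.exp (-δ * (l1 (x - v) + l1 (p - v)))) →
          (∀ (κ₁ κ₂ : Fin (3 + 1)) (v' x p : Site (3 + 1)) (f b : Fib 3),
              |∑' v, W κ₁ v κ₂ v' x p f b| ≤ g * Real.exp (-δ * (l1 (x - v') + l1 (p - v')))) →
          (∀ (κ₁ κ₂ : Fin (3 + 1)) (x p : Site (3 + 1)) (f b : Fib 3),
              |∑' v, ∑' v', W κ₁ v κ₂ v' x p f b| ≤ g * Real.exp (-δ * l1 (p - x))) →
          (∀ (κ : Fin (3 + 1)) (v w x p : Site (3 + 1)) (f b : Fib 3),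
              |∑ μ, (W κ v μ (w - unitVec μ) x p f b - W κ v μ w x p f b)|
                ≤ g * Real.exp (-δ * l1 (w - v)) * Real.exp (-δ * (l1 (x - v) + l1 (p - v)))) →
          (∀ (κ' : Fin (3 + 1)) (w v' x p : Site (3 + 1)) (f b : Fib 3),
              |∑ κ, (W κ (w - unitVec κ) κ' v' x p f b - W κ w κ' v' x p f b)|
                ≤ g * Real.exp (-δ * l1 (v' - w)) * Real.exp (-δ * (l1 (x - w) + l1 (p - w)))) →
          LocStencil₂
            (legChain (fun _ : ℕ => -((cE₂ * (Lc : ℝ) ^ (2 * (3 + 1))) * ((Lc : ℝ) ^ (3 + 1))⁻¹))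
              (fun m => unitK (sfStep Lc m) (smStep 3 Lc m) (GcombSh (d := 3) Lc m)) Lc n (k + 1)
              (fun κ u κ' u' => bsumPow Lc (k + 1) (W κ u κ' u')))
            (θ * C + Cg * g) δ)
    (HWs : ∃ κ₁ : ℝ, 0 < κ₁ ∧ ∀ δS δ : ℝ, 0 < δ → δ ≤ δS → 18 * (((3 : ℕ) : ℝ) + 1) * δ ≤ κ₁ → 108 * (((3 : ℕ) : ℝ) + 1) * δ ≤ δS * (Lc : ℝ) →
      ∀ k₀ : ℕ, ∃ A B : ℝ, 1 ≤ A ∧ 0 ≤ B ∧ ∀ (p q : ℕ) (W : (Fin (3 + 1) → (Fin (3 + 1) → ℤ) → Fin (3 + 1) → (Fin (3 + 1) → ℤ) → MKer (3 + 1) (Fib 3))) (C g : ℝ), q < k₀ →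
          (∃ B' : ℝ, ∀ κ u κ' u' x z a b, |W κ u κ' u' x z a b| ≤ B') → LocStencil₂ W C δS →
          (∀ (κ₁ : Fin (3 + 1)) (v : Site (3 + 1)) (κ₂ : Fin (3 + 1)) (x p : Site (3 + 1)) (f b : Fib 3),
              |∑' v', W κ₁ v κ₂ v' x p f b| ≤ g * Real.exp (-δS * (l1 (x - v) + l1 (p - v)))) →
          (∀ (κ₁ κ₂ : Fin (3 + 1)) (v' x p : Site (3 + 1)) (f b : Fib 3),
              |∑' v, W κ₁ v κ₂ v' x p f b| ≤ g * Real.exp (-δS * (l1 (x - v') + l1 (p - v')))) →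
          (∀ (κ₁ κ₂ : Fin (3 + 1)) (x p : Site (3 + 1)) (f b : Fib 3),
              |∑' v, ∑' v', W κ₁ v κ₂ v' x p f b| ≤ g * Real.exp (-δS * l1 (p - x))) →
          (∀ (κ : Fin (3 + 1)) (v w x p : Site (3 + 1)) (f b : Fib 3),
              |∑ μ, (W κ v μ (w - unitVec μ) x p f b - W κ v μ w x p f b)|
                ≤ g * Real.exp (-δS * l1 (w - v)) * Real.exp (-δS * (l1 (x - v) + l1 (p - v)))) →
          (∀ (κ' : Fin (3 + 1)) (w v' x p : Site (3 + 1)) (f b : Fib 3),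
              |∑ κ, (W κ (w - unitVec κ) κ' v' x p f b - W κ w κ' v' x p f b)|
                ≤ g * Real.exp (-δS * l1 (v' - w)) * Real.exp (-δS * (l1 (x - w) + l1 (p - w)))) →
          LocStencil₂
            (legChain (fun _ : ℕ => -((cE₂ * (Lc : ℝ) ^ (2 * (3 + 1))) * ((Lc : ℝ) ^ (3 + 1))⁻¹))
              (fun m => unitK (sfStep Lc m) (smStep 3 Lc m) (GcombSh (d := 3) Lc m)) Lc p q
              (fun κ u κ' u' => bsumPow Lc q (W κ u κ' u')))
            (A * C + B * g) δ)
    (HWΔ : ∃ κΔ ν : ℝ, 0 < κΔ ∧ 0 ≤ ν ∧ ν < 1 ∧ ∀ δ δD : ℝ, 0 < δD → δD ≤ δ → 18 * (((3 : ℕ) : ℝ) + 1) * δD ≤ κΔ → 108 * (((3 : ℕ) : ℝ) + 1) * δD ≤ δ * (Lc : ℝ) →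
      ∀ k₀ : ℕ, ∃ AΔ BΔ : ℝ, 0 ≤ AΔ ∧ 0 ≤ BΔ ∧ ∀ (l q : ℕ) (W : (Fin (3 + 1) → (Fin (3 + 1) → ℤ) → Fin (3 + 1) → (Fin (3 + 1) → ℤ) → MKer (3 + 1) (Fib 3))) (C g : ℝ), q < k₀ →
          (∃ B : ℝ, ∀ κ u κ' u' x z a b, |W κ u κ' u' x z a b| ≤ B) → LocStencil₂ W C δ →
          (∀ (κ₁ : Fin (3 + 1)) (v : Site (3 + 1)) (κ₂ : Fin (3 + 1)) (x p : Site (3 + 1)) (f b : Fib 3),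
              |∑' v', W κ₁ v κ₂ v' x p f b| ≤ g * Real.exp (-δ * (l1 (x - v) + l1 (p - v)))) →
          (∀ (κ₁ κ₂ : Fin (3 + 1)) (v' x p : Site (3 + 1)) (f b : Fib 3),
              |∑' v, W κ₁ v κ₂ v' x p f b| ≤ g * Real.exp (-δ * (l1 (x - v') + l1 (p - v')))) →
          (∀ (κ₁ κ₂ : Fin (3 + 1)) (x p : Site (3 + 1)) (f b : Fib 3),
              |∑' v, ∑' v', W κ₁ v κ₂ v' x p f b| ≤ g * Real.exp (-δ * l1 (p - x))) →
          (∀ (κ : Fin (3 + 1)) (v w x p : Site (3 + 1)) (f b : Fib 3),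
              |∑ μ, (W κ v μ (w - unitVec μ) x p f b - W κ v μ w x p f b)|
                ≤ g * Real.exp (-δ * l1 (w - v)) * Real.exp (-δ * (l1 (x - v) + l1 (p - v)))) →
          (∀ (κ' : Fin (3 + 1)) (w v' x p : Site (3 + 1)) (f b : Fib 3),
              |∑ κ, (W κ (w - unitVec κ) κ' v' x p f b - W κ w κ' v' x p f b)|
                ≤ g * Real.exp (-δ * l1 (v' - w)) * Real.exp (-δ * (l1 (x - w) + l1 (p - w)))) →
          LocStencil₂
            (legChain (fun _ : ℕ => -((cE₂ * (Lc : ℝ) ^ (2 * (3 + 1))) * ((Lc : ℝ) ^ (3 + 1))⁻¹))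
              (fun m => unitK (sfStep Lc m) (smStep 3 Lc m) (GcombSh (d := 3) Lc m)) Lc (l + 2) q
              (fun κ u κ' u' => bsumPow Lc q
                ((legStepB (fun _ : ℕ => -((cE₂ * (Lc : ℝ) ^ (2 * (3 + 1))) * ((Lc : ℝ) ^ (3 + 1))⁻¹))
                    (fun m => unitK (sfStep Lc m) (smStep 3 Lc m) (GcombSh (d := 3) Lc m)) Lc (l + 1) W
                  - legStepB (fun _ : ℕ => -((cE₂ * (Lc : ℝ) ^ (2 * (3 + 1))) * ((Lc : ℝ) ^ (3 + 1))⁻¹))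
                    (fun m => unitK (sfStep Lc m) (smStep 3 Lc m) (GcombSh (d := 3) Lc m)) Lc l W) κ u κ' u')))
            ((AΔ * C + BΔ * g) * ν ^ l) δD)
    {δ6 Cb cb θb : ℝ} (hδ6 : 0 < δ6) (hθb0 : 0 ≤ θb) (hθb1 : θb < 1)
    (Hb : ∀ n : ℕ, LocStencil₂ (fun κ u κ' u' => (cE₂ * (Lc : ℝ) ^ (2 * (3 + 1))) • mmRead Lc (K3OfK (unitK (sfStep Lc n) (smStep 3 Lc n) (GcombSh (d := 3) Lc n)) Lc (unitS (sfStep Lc n) (smStep 3 Lc n) (SpureCombOf tabs cE cVH cΛ n)) (unitM (sfStep Lc n) (smStep 3 Lc n) (tabs.M n)) (W2SymOfK (unitK (sfStep Lc n) (smStep 3 Lc n) (GcombSh (d := 3) Lc n)) Lc (unitS (sfStep Lc n) (smStep 3 Lc n) (SpureCombOf tabs cE cVH cΛ n)) (unitM (sfStep Lc n) (smStep 3 Lc n) (tabs.M n)) 0 (unitM₂ (sfStep Lc n) (smStep 3 Lc n) (M2Of 3 Lc tabs.mixFF n))) κ u κ' u') + cB • tabs.vh₂S κ u κ' u') Cb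 δ6)
    (Hbd : ∀ l : ℕ, LocStencil₂ ((fun κ u κ' u' => (cE₂ * (Lc : ℝ) ^ (2 * (3 + 1))) • mmRead Lc (K3OfK (unitK (sfStep Lc (l + 1)) (smStep 3 Lc (l + 1)) (GcombSh (d := 3) Lc (l + 1))) Lc (unitS (sfStep Lc (l + 1)) (smStep 3 Lc (l + 1)) (SpureCombOf tabs cE cVH cΛ (l + 1))) (unitM (sfStep Lc (l + 1)) (smStep 3 Lc (l + 1)) (tabs.M (l + 1))) (W2SymOfK (unitK (sfStep Lc (l + 1)) (smStep 3 Lc (l + 1)) (GcombSh (d := 3) Lc (l + 1))) Lc (unitS (sfStep Lc (l + 1)) (smStep 3 Lc (l + 1)) (SpureCombOf tabs cE cVH cΛ (l + 1))) (unitM (sfStep Lc (l + 1)) (smStep 3 Lc (l + 1)) (tabs.M (l + 1))) 0 (unitM₂ (sfStep Lc (l + 1)) (smStep 3 Lc (l + 1)) (M2Of 3 Lc tabs.mixFF (l + 1)))) κ u κ' u') + cB • tabs.vh₂S κ u κ' u')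
      - (fun κ u κ' u' => (cE₂ * (Lc : ℝ) ^ (2 * (3 + 1))) • mmRead Lc (K3OfK (unitK (sfStep Lc l) (smStep 3 Lc l) (GcombSh (d := 3) Lc l)) Lc (unitS (sfStep Lc l) (smStep 3 Lc l) (SpureCombOf tabs cE cVH cΛ l)) (unitM (sfStep Lc l) (smStep 3 Lc l) (tabs.M l)) (W2SymOfK (unitK (sfStep Lc l) (smStep 3 Lc l) (GcombSh (d := 3) Lc l)) Lc (unitS (sfStep Lc l) (smStep 3 Lc l) (SpureCombOf tabs cE cVH cΛ l)) (unitM (sfStep Lc l) (smStep 3 Lc l) (tabs.M l)) 0 (unitM₂ (sfStep Lc l) (smStep 3 Lc l) (M2Of 3 Lc tabs.mixFF l))) κ u κ' u') + cB • tabs.vh₂S κ u κ' u')) (cb * θb ^ l) δ6)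
    {δ₃ σ₁ σ₂ σ₁d σ₂d ν₃ : ℝ} (hδ₃ : 0 < δ₃) (hν₃0 : 0 ≤ ν₃) (hν₃1 : ν₃ < 1)
    (Hh₁ : ∀ n : ℕ, LocStencil₂ (fun (_ : Fin (3 + 1)) (p : Fin (3 + 1) → ℤ) (κ' : Fin (3 + 1)) (u' : Fin (3 + 1) → ℤ) =>
      divV (fun κ₁ u₁ => (((1 : ℝ) / 2) • (unitS₂ (sfStep Lc n) (smStep 3 Lc n) (T2RecOf 3 Lc (GcombSh Lc) (SpureCombOf tabs cE cVH cΛ) tabs.M cE₂ cB Tc tabs.vh₂S tabs.mixFF n) + ε • fun κ u κ' u' => sgnK (trK ((unitS₂ (sfStep Lc n) (smStep 3 Lc n) (T2RecOf 3 Lc (GcombSh Lc) (SpureCombOf tabs cE cVH cΛ) tabs.M cE₂ cB Tc tabs.vh₂S tabs.mixFF n)) κ u κ' u')))) κ₁ u₁ κ' u') p) σ₁ δ₃)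
    (Hh₂ : ∀ n : ℕ, LocStencil₂ (fun (κ : Fin (3 + 1)) (u : Fin (3 + 1) → ℤ) (_ : Fin (3 + 1)) (p : Fin (3 + 1) → ℤ) =>
      divV (fun κ₁ u₁ => (((1 : ℝ) / 2) • (unitS₂ (sfStep Lc n) (smStep 3 Lc n) (T2RecOf 3 Lc (GcombSh Lc) (SpureCombOf tabs cE cVH cΛ) tabs.M cE₂ cB Tc tabs.vh₂S tabs.mixFF n) + ε • fun κ u κ' u' => sgnK (trK ((unitS₂ (sfStep Lc n) (smStep 3 Lc n) (T2RecOf 3 Lc (GcombSh Lc) (SpureCombOf tabs cE cVH cΛ) tabs.M cE₂ cB Tc tabs.vh₂S tabs.mixFF n)) κ u κ' u')))) κ u κ₁ u₁) p) σ₂ δ₃)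
    (Hh₁d : ∀ n : ℕ, LocStencil₂ (fun (_ : Fin (3 + 1)) (p : Fin (3 + 1) → ℤ) (κ' : Fin (3 + 1)) (u' : Fin (3 + 1) → ℤ) =>
      divV (fun κ₁ u₁ => ((((1 : ℝ) / 2) • (unitS₂ (sfStep Lc (n + 1)) (smStep 3 Lc (n + 1)) (T2RecOf 3 Lc (GcombSh Lc) (SpureCombOf tabs cE cVH cΛ) tabs.M cE₂ cB Tc tabs.vh₂S tabs.mixFF (n + 1)) + ε • fun κ u κ' u' => sgnK (trK ((unitS₂ (sfStep Lc (n + 1)) (smStep 3 Lc (n + 1)) (T2RecOf 3 Lc (GcombSh Lc) (SpureCombOf tabs cE cVH cΛ) tabs.M cE₂ cB Tc tabs.vh₂S tabs.mixFF (n + 1))) κ u κ' u'))))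
        - (((1 : ℝ) / 2) • (unitS₂ (sfStep Lc n) (smStep 3 Lc n) (T2RecOf 3 Lc (GcombSh Lc) (SpureCombOf tabs cE cVH cΛ) tabs.M cE₂ cB Tc tabs.vh₂S tabs.mixFF n) + ε • fun κ u κ' u' => sgnK (trK ((unitS₂ (sfStep Lc n) (smStep 3 Lc n) (T2RecOf 3 Lc (GcombSh Lc) (SpureCombOf tabs cE cVH cΛ) tabs.M cE₂ cB Tc tabs.vh₂S tabs.mixFF n)) κ u κ' u'))))) κ₁ u₁ κ' u') p) (σ₁d * ν₃ ^ n) δ₃)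
    (Hh₂d : ∀ n : ℕ, LocStencil₂ (fun (κ : Fin (3 + 1)) (u : Fin (3 + 1) → ℤ) (_ : Fin (3 + 1)) (p : Fin (3 + 1) → ℤ) =>
      divV (fun κ₁ u₁ => ((((1 : ℝ) / 2) • (unitS₂ (sfStep Lc (n + 1)) (smStep 3 Lc (n + 1)) (T2RecOf 3 Lc (GcombSh Lc) (SpureCombOf tabs cE cVH cΛ) tabs.M cE₂ cB Tc tabs.vh₂S tabs.mixFF (n + 1)) + ε • fun κ u κ' u' => sgnK (trK ((unitS₂ (sfStep Lc (n + 1)) (smStep 3 Lc (n + 1)) (T2RecOf 3 Lc (GcombSh Lc) (SpureCombOf tabs cE cVH cΛ) tabs.M cE₂ cB Tc tabs.vh₂S tabs.mixFF (n + 1))) κ u κ' u'))))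
        - (((1 : ℝ) / 2) • (unitS₂ (sfStep Lc n) (smStep 3 Lc n) (T2RecOf 3 Lc (GcombSh Lc) (SpureCombOf tabs cE cVH cΛ) tabs.M cE₂ cB Tc tabs.vh₂S tabs.mixFF n) + ε • fun κ u κ' u' => sgnK (trK ((unitS₂ (sfStep Lc n) (smStep 3 Lc n) (T2RecOf 3 Lc (GcombSh Lc) (SpureCombOf tabs cE cVH cΛ) tabs.M cE₂ cB Tc tabs.vh₂S tabs.mixFF n)) κ u κ' u'))))) κ u κ₁ u₁) p) (σ₂d * ν₃ ^ n) δ₃) :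
    ∃ δ CL c ϑ : ℝ, 0 < δ ∧ 0 ≤ c ∧ 0 < ϑ ∧ ϑ < 1 ∧
      (∀ l, LocStencil₂ (fun κ u κ' u' => fun (p z : Fin (3 + 1) → ℤ) (_ : Fib 3) (b : Fib 3) =>
        ∑ β : Fin (3 + 1), ((((1 : ℝ) / 2) • (unitS₂ (sfStep Lc l) (smStep 3 Lc l) (T2RecOf 3 Lc (GcombSh Lc) (SpureCombOf tabs cE cVH cΛ) tabs.M cE₂ cB Tc tabs.vh₂S tabs.mixFF l) + ε • fun κ u κ' u' => sgnK (trK ((unitS₂ (sfStep Lc l) (smStep 3 Lc l) (T2RecOf 3 Lc (GcombSh Lc) (SpureCombOf tabs cE cVH cΛ) tabs.M cE₂ cB Tc tabs.vh₂S tabs.mixFF l)) κ u κ' u')))) κ u κ' u' p z (Sum.inl β) b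
          - (((1 : ℝ) / 2) • (unitS₂ (sfStep Lc l) (smStep 3 Lc l) (T2RecOf 3 Lc (GcombSh Lc) (SpureCombOf tabs cE cVH cΛ) tabs.M cE₂ cB Tc tabs.vh₂S tabs.mixFF l) + ε • fun κ u κ' u' => sgnK (trK ((unitS₂ (sfStep Lc l) (smStep 3 Lc l) (T2RecOf 3 Lc (GcombSh Lc) (SpureCombOf tabs cE cVH cΛ) tabs.M cE₂ cB Tc tabs.vh₂S tabs.mixFF l)) κ u κ' u')))) κ u κ' u' (p - AffineAveraging.unitVec β) z (Sum.inl β) b)) CL δ) ∧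
      (∀ l, LocStencil₂ (fun κ u κ' u' => fun (x p : Fin (3 + 1) → ℤ) (a : Fib 3) (_ : Fib 3) =>
        ∑ β : Fin (3 + 1), ((((1 : ℝ) / 2) • (unitS₂ (sfStep Lc l) (smStep 3 Lc l) (T2RecOf 3 Lc (GcombSh Lc) (SpureCombOf tabs cE cVH cΛ) tabs.M cE₂ cB Tc tabs.vh₂S tabs.mixFF l) + ε • fun κ u κ' u' => sgnK (trK ((unitS₂ (sfStep Lc l) (smStep 3 Lc l) (T2RecOf 3 Lc (GcombSh Lc) (SpureCombOf tabs cE cVH cΛ) tabs.M cE₂ cB Tc tabs.vh₂S tabs.mixFF l)) κ u κ' u')))) κ u κ' u' x p a (Sum.inl β)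
          - (((1 : ℝ) / 2) • (unitS₂ (sfStep Lc l) (smStep 3 Lc l) (T2RecOf 3 Lc (GcombSh Lc) (SpureCombOf tabs cE cVH cΛ) tabs.M cE₂ cB Tc tabs.vh₂S tabs.mixFF l) + ε • fun κ u κ' u' => sgnK (trK ((unitS₂ (sfStep Lc l) (smStep 3 Lc l) (T2RecOf 3 Lc (GcombSh Lc) (SpureCombOf tabs cE cVH cΛ) tabs.M cE₂ cB Tc tabs.vh₂S tabs.mixFF l)) κ u κ' u')))) κ u κ' u' x (p - AffineAveraging.unitVec β) a (Sum.inl β))) CL δ) ∧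
      (∀ l, LocStencil₂ (fun κ u κ' u' => fun (p z : Fin (3 + 1) → ℤ) (_ : Fib 3) (b : Fib 3) =>
        ∑ β : Fin (3 + 1), (((((1 : ℝ) / 2) • (unitS₂ (sfStep Lc (l + 1)) (smStep 3 Lc (l + 1)) (T2RecOf 3 Lc (GcombSh Lc) (SpureCombOf tabs cE cVH cΛ) tabs.M cE₂ cB Tc tabs.vh₂S tabs.mixFF (l + 1)) + ε • fun κ u κ' u' => sgnK (trK ((unitS₂ (sfStep Lc (l + 1)) (smStep 3 Lc (l + 1)) (T2RecOf 3 Lc (GcombSh Lc) (SpureCombOf tabs cE cVH cΛ) tabs.M cE₂ cB Tc tabs.vh₂S tabs.mixFF (l + 1))) κ u κ' u'))))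
          - (((1 : ℝ) / 2) • (unitS₂ (sfStep Lc l) (smStep 3 Lc l) (T2RecOf 3 Lc (GcombSh Lc) (SpureCombOf tabs cE cVH cΛ) tabs.M cE₂ cB Tc tabs.vh₂S tabs.mixFF l) + ε • fun κ u κ' u' => sgnK (trK ((unitS₂ (sfStep Lc l) (smStep 3 Lc l) (T2RecOf 3 Lc (GcombSh Lc) (SpureCombOf tabs cE cVH cΛ) tabs.M cE₂ cB Tc tabs.vh₂S tabs.mixFF l)) κ u κ' u'))))) κ u κ' u' p z (Sum.inl β) b
          - ((((1 : ℝ) / 2) • (unitS₂ (sfStep Lc (l + 1)) (smStep 3 Lc (l + 1)) (T2RecOf 3 Lc (GcombSh Lc) (SpureCombOf tabs cE cVH cΛ) tabs.M cE₂ cB Tc tabs.vh₂S tabs.mixFF (l + 1)) + ε • fun κ u κ' u' => sgnK (trK ((unitS₂ (sfStep Lc (l + 1)) (smStep 3 Lc (l + 1)) (T2RecOf 3 Lc (GcombSh Lc) (SpureCombOf tabs cE cVH cΛ) tabs.M cE₂ cB Tc tabs.vh₂S tabs.mixFF (l + 1))) κ u κ' u'))))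
          - (((1 : ℝ) / 2) • (unitS₂ (sfStep Lc l) (smStep 3 Lc l) (T2RecOf 3 Lc (GcombSh Lc) (SpureCombOf tabs cE cVH cΛ) tabs.M cE₂ cB Tc tabs.vh₂S tabs.mixFF l) + ε • fun κ u κ' u' => sgnK (trK ((unitS₂ (sfStep Lc l) (smStep 3 Lc l) (T2RecOf 3 Lc (GcombSh Lc) (SpureCombOf tabs cE cVH cΛ) tabs.M cE₂ cB Tc tabs.vh₂S tabs.mixFF l)) κ u κ' u'))))) κ u κ' u' (p - AffineAveraging.unitVec β) z (Sum.inl β) b)) (c * ϑ ^ l) δ) ∧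
      (∀ l, LocStencil₂ (fun κ u κ' u' => fun (x p : Fin (3 + 1) → ℤ) (a : Fib 3) (_ : Fib 3) =>
        ∑ β : Fin (3 + 1), (((((1 : ℝ) / 2) • (unitS₂ (sfStep Lc (l + 1)) (smStep 3 Lc (l + 1)) (T2RecOf 3 Lc (GcombSh Lc) (SpureCombOf tabs cE cVH cΛ) tabs.M cE₂ cB Tc tabs.vh₂S tabs.mixFF (l + 1)) + ε • fun κ u κ' u' => sgnK (trK ((unitS₂ (sfStep Lc (l + 1)) (smStep 3 Lc (l + 1)) (T2RecOf 3 Lc (GcombSh Lc) (SpureCombOf tabs cE cVH cΛ) tabs.M cE₂ cB Tc tabs.vh₂S tabs.mixFF (l + 1))) κ u κ' u'))))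
          - (((1 : ℝ) / 2) • (unitS₂ (sfStep Lc l) (smStep 3 Lc l) (T2RecOf 3 Lc (GcombSh Lc) (SpureCombOf tabs cE cVH cΛ) tabs.M cE₂ cB Tc tabs.vh₂S tabs.mixFF l) + ε • fun κ u κ' u' => sgnK (trK ((unitS₂ (sfStep Lc l) (smStep 3 Lc l) (T2RecOf 3 Lc (GcombSh Lc) (SpureCombOf tabs cE cVH cΛ) tabs.M cE₂ cB Tc tabs.vh₂S tabs.mixFF l)) κ u κ' u'))))) κ u κ' u' x p a (Sum.inl β)
          - ((((1 : ℝ) / 2) • (unitS₂ (sfStep Lc (l + 1)) (smStep 3 Lc (l + 1)) (T2RecOf 3 Lc (GcombSh Lc) (SpureCombOf tabs cE cVH cΛ) tabs.M cE₂ cB Tc tabs.vh₂S tabs.mixFF (l + 1)) + ε • fun κ u κ' u' => sgnK (trK ((unitS₂ (sfStep Lc (l + 1)) (smStep 3 Lc (l + 1)) (T2RecOf 3 Lc (GcombSh Lc) (SpureCombOf tabs cE cVH cΛ) tabs.M cE₂ cB Tc tabs.vh₂S tabs.mixFF (l + 1))) κ u κ' u'))))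
          - (((1 : ℝ) / 2) • (unitS₂ (sfStep Lc l) (smStep 3 Lc l) (T2RecOf 3 Lc (GcombSh Lc) (SpureCombOf tabs cE cVH cΛ) tabs.M cE₂ cB Tc tabs.vh₂S tabs.mixFF l) + ε • fun κ u κ' u' => sgnK (trK ((unitS₂ (sfStep Lc l) (smStep 3 Lc l) (T2RecOf 3 Lc (GcombSh Lc) (SpureCombOf tabs cE cVH cΛ) tabs.M cE₂ cB Tc tabs.vh₂S tabs.mixFF l)) κ u κ' u'))))) κ u κ' u' x (p - AffineAveraging.unitVec β) a (Sum.inl β))) (c * ϑ ^ l) δ) := by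
  have hLc1 : 1 ≤ Lc := NeZero.one_le
  have hLpos : (0 : ℝ) < (Lc : ℝ) := by exact_mod_cast (show 0 < Lc from hLc1)
  have hε1 : |ε| ≤ 1 := by have h1 : |ε| * |ε| = 1 := by { rw [← abs_mul, hε, abs_one] }; nlinarith [abs_nonneg ε]
  -- the letters: the source rows halved and right-divergenced; the level-0 member (leaf-01's class row); ONE common rate `δ7`
  obtain ⟨Cz, δz, hδz, hz⟩ := locStencil₂_unitS₂_T2RecOf_comb tabs cE cVH cΛ cE₂ cB Tc 0
  set δ7 : ℝ := min δ6 δz with hδ7def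
  have hδ7 : 0 < δ7 := lt_min hδ6 hδz
  have h71 : δ7 ≤ δ6 := min_le_left _ _
  have h72 : δ7 ≤ δz := min_le_right _ _
  have hCb : 0 ≤ Cb := (Hb 0).nonneg
  have hcb : 0 ≤ cb := by have h := (Hbd 0).nonneg; rwa [pow_zero, mul_one] at h
  have HS6 : ∀ n : ℕ, LocStencil₂ (fun κ u κ' u' => rdiv ((((1 : ℝ) / 2) • ((fun κ u κ' u' => (cE₂ * (Lc : ℝ) ^ (2 * (3 + 1))) • mmRead Lc (K3OfK (unitK (sfStep Lc n) (smStep 3 Lc n) (GcombSh (d := 3) Lc n)) Lc (unitS (sfStep Lc n) (smStep 3 Lc n) (SpureCombOf tabs cE cVH cΛ n)) (unitM (sfStep Lc n) (smStep 3 Lc n) (tabs.M n)) (W2SymOfK (unitK (sfStep Lc n) (smStep 3 Lc n) (GcombSh (d := 3) Lc n)) Lc (unitS (sfStep Lc n) (smStep 3 Lc n) (SpureCombOf tabs cE cVH cΛ n)) (unitM (sfStep Lc n) (smStep 3 Lc n) (tabs.M n)) 0 (unitM₂ (sfStep Lc n) (smStep 3 Lc n) (M2Of 3 Lc tabs.mixFF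 n))) κ u κ' u') + cB • tabs.vh₂S κ u κ' u') + ε • fun κ u κ' u' => sgnK (trK (((fun κ u κ' u' => (cE₂ * (Lc : ℝ) ^ (2 * (3 + 1))) • mmRead Lc (K3OfK (unitK (sfStep Lc n) (smStep 3 Lc n) (GcombSh (d := 3) Lc n)) Lc (unitS (sfStep Lc n) (smStep 3 Lc n) (SpureCombOf tabs cE cVH cΛ n)) (unitM (sfStep Lc n) (smStep 3 Lc n) (tabs.M n)) (W2SymOfK (unitK (sfStep Lc n) (smStep 3 Lc n) (GcombSh (d := 3) Lc n)) Lc (unitS (sfStep Lc n) (smStep 3 Lc n) (SpureCombOf tabs cE cVH cΛ n)) (unitM (sfStep Lc n) (smStep 3 Lc n) (tabs.M n)) 0 (unitM₂ (sfStep Lc n) (smStep 3 Lc n) (M2Of 3 Lc tabs.mixFF n))) κ u κ' u') + cB • tabs.vh₂S κ u κ' u')) κ u κ' u')))) κ u κ' u'))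
      ((((3 + 1 : ℕ) : ℝ) * (Real.exp δ7 + 1) * Cb)) δ7 := fun n =>
    locStencil₂_rdiv (fun κ u κ' u' => (locStencil₂_half ((Hb n).mono h71) hε1) κ u κ' u') hδ7.le
  have HS6' : ∀ l : ℕ, LocStencil₂ ((fun κ u κ' u' => rdiv ((((1 : ℝ) / 2) • ((fun κ u κ' u' => (cE₂ * (Lc : ℝ) ^ (2 * (3 + 1))) • mmRead Lc (K3OfK (unitK (sfStep Lc (l + 1)) (smStep 3 Lc (l + 1)) (GcombSh (d := 3) Lc (l + 1))) Lc (unitS (sfStep Lc (l + 1)) (smStep 3 Lc (l + 1)) (SpureCombOf tabs cE cVH cΛ (l + 1))) (unitM (sfStep Lc (l + 1)) (smStep 3 Lc (l + 1)) (tabs.M (l + 1))) (W2SymOfK (unitK (sfStep Lc (l + 1)) (smStep 3 Lc (l + 1)) (GcombSh (d := 3) Lc (l + 1))) Lc (unitS (sfStep Lc (l + 1)) (smStep 3 Lc (l + 1)) (SpureCombOf tabs cE cVH cΛ (l + 1))) (unitM (sfStep Lc (l + 1)) (smStep 3 Lc (l + 1)) (tabs.M (l + 1))) 0 (unitM₂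 (sfStep Lc (l + 1)) (smStep 3 Lc (l + 1)) (M2Of 3 Lc tabs.mixFF (l + 1)))) κ u κ' u') + cB • tabs.vh₂S κ u κ' u') + ε • fun κ u κ' u' => sgnK (trK (((fun κ u κ' u' => (cE₂ * (Lc : ℝ) ^ (2 * (3 + 1))) • mmRead Lc (K3OfK (unitK (sfStep Lc (l + 1)) (smStep 3 Lc (l + 1)) (GcombSh (d := 3) Lc (l + 1))) Lc (unitS (sfStep Lc (l + 1)) (smStep 3 Lc (l + 1)) (SpureCombOf tabs cE cVH cΛ (l + 1))) (unitM (sfStep Lc (l + 1)) (smStep 3 Lc (l + 1)) (tabs.M (l + 1))) (W2SymOfK (unitK (sfStep Lc (l + 1)) (smStep 3 Lc (l + 1)) (GcombSh (d := 3) Lc (l + 1))) Lc (unitS (sfStep Lc (l + 1)) (smStep 3 Lc (l + 1)) (SpureCombOf tabs cE cVH cΛ (l + 1))) (unitM (sfStep Lc (l + 1)) (smStep 3 Lc (l + 1)) (tabs.M (l + 1))) 0 (unitM₂ (sfStep Lc (l + 1)) (smStep 3 Lc (l + 1)) (M2Of 3 Lc tabs.mixFF (l + 1)))) κ u κ' u')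 + cB • tabs.vh₂S κ u κ' u')) κ u κ' u')))) κ u κ' u'))
      - (fun κ u κ' u' => rdiv ((((1 : ℝ) / 2) • ((fun κ u κ' u' => (cE₂ * (Lc : ℝ) ^ (2 * (3 + 1))) • mmRead Lc (K3OfK (unitK (sfStep Lc l) (smStep 3 Lc l) (GcombSh (d := 3) Lc l)) Lc (unitS (sfStep Lc l) (smStep 3 Lc l) (SpureCombOf tabs cE cVH cΛ l)) (unitM (sfStep Lc l) (smStep 3 Lc l) (tabs.M l)) (W2SymOfK (unitK (sfStep Lc l) (smStep 3 Lc l) (GcombSh (d := 3) Lc l)) Lc (unitS (sfStep Lc l) (smStep 3 Lc l) (SpureCombOf tabs cE cVH cΛ l)) (unitM (sfStep Lc l) (smStep 3 Lc l) (tabs.M l)) 0 (unitM₂ (sfStep Lc l) (smStep 3 Lc l) (M2Of 3 Lc tabs.mixFF l))) κ u κ' u') + cB • tabs.vh₂S κ u κ' u') + ε • fun κ u κ' u' => sgnK (trK (((fun κ u κ' u' => (cE₂ * (Lc : ℝ) ^ (2 * (3 + 1))) • mmRead Lc (K3OfK (unitK (sfStep Lc l) (smStep 3 Lc l) (GcombSh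 (d := 3) Lc l)) Lc (unitS (sfStep Lc l) (smStep 3 Lc l) (SpureCombOf tabs cE cVH cΛ l)) (unitM (sfStep Lc l) (smStep 3 Lc l) (tabs.M l)) (W2SymOfK (unitK (sfStep Lc l) (smStep 3 Lc l) (GcombSh (d := 3) Lc l)) Lc (unitS (sfStep Lc l) (smStep 3 Lc l) (SpureCombOf tabs cE cVH cΛ l)) (unitM (sfStep Lc l) (smStep 3 Lc l) (tabs.M l)) 0 (unitM₂ (sfStep Lc l) (smStep 3 Lc l) (M2Of 3 Lc tabs.mixFF l))) κ u κ' u') + cB • tabs.vh₂S κ u κ' u')) κ u κ' u')))) κ u κ' u'))) ((((3 + 1 : ℕ) : ℝ) * (Real.exp δ7 + 1) * cb) * θb ^ l) δ7 := by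
    intro l
    have hc := locStencil₂_rdiv (fun κ u κ' u' => (locStencil₂_half ((Hbd l).mono h71) hε1) κ u κ' u') hδ7.le
    rw [← rdiv_comp_sub, half_sub]
    exact locStencil₂_mono hc (le_of_eq (by ring))
  have Hx06 : LocStencil₂ (fun κ u κ' u' => rdiv ((((1 : ℝ) / 2) • (unitS₂ (sfStep Lc 0) (smStep 3 Lc 0) (T2RecOf 3 Lc (GcombSh Lc) (SpureCombOf tabs cE cVH cΛ) tabs.M cE₂ cB Tc tabs.vh₂S tabs.mixFF 0) + ε • fun κ u κ' u' => sgnK (trK ((unitS₂ (sfStep Lc 0) (smStep 3 Lc 0) (T2RecOf 3 Lc (GcombSh Lc) (SpureCombOf tabs cE cVH cΛ) tabs.M cE₂ cB Tc tabs.vh₂S tabs.mixFF 0)) κ u κ' u')))) κ u κ' u')) ((((3 + 1 : ℕ) : ℝ) * (Real.exp δ7 + 1) * Cz)) δ7 :=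
    locStencil₂_rdiv (fun κ u κ' u' => (locStencil₂_half (hz.mono h72) hε1) κ u κ' u') hδ7.le
  set CF : ℝ := (((3 + 1 : ℕ) : ℝ) * (Real.exp δ7 + 1) * Cb) with hCFdef
  set cF : ℝ := (((3 + 1 : ℕ) : ℝ) * (Real.exp δ7 + 1) * cb) with hcFdef
  set C₀ : ℝ := (((3 + 1 : ℕ) : ℝ) * (Real.exp δ7 + 1) * Cz) with hC₀def
  have hCF : 0 ≤ CF := (HS6 0).nonneg
  have hC₀ : 0 ≤ C₀ := Hx06.nonneg
  have hcF : 0 ≤ cF := by have h := (HS6' 0).nonneg; rwa [pow_zero, mul_one] at h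
  -- MY `WindowSlotRows` §3 (the sources' five rows at `δ7/3`) and MY `LegLetterWindowRows` (the members' five rows at `δ₃/3`)
  obtain ⟨Γ₄, hΓ₄0, hΓ₄⟩ := exists_windowRows_of_locStencil₂ 3 hδ7
  obtain ⟨Γ₂, hΓ₂0, hΓ₂⟩ := exists_windowRows_legLetter_of_divRows 3 hδ₃
  -- the three window theorems' rate ceilings (rate-, length-free)
  obtain ⟨δ₁, hδ₁, HW1'⟩ := HW1
  obtain ⟨κ₁, hκ₁, HWs'⟩ := HWs
  obtain ⟨κΔ, νΔ, hκΔ, hνΔ0, hνΔ1, HWΔ'⟩ := HWΔ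
  -- THE RATES: `δS`, then `δ`, then `δD` — all before the length
  have hc4 : (0 : ℝ) < ((3 : ℕ) : ℝ) + 1 := by positivity
  have h18 : (0 : ℝ) < 18 * (((3 : ℕ) : ℝ) + 1) := by positivity
  have h108 : (0 : ℝ) < 108 * (((3 : ℕ) : ℝ) + 1) := by positivity
  set δS : ℝ := δ7 / 3 with hδS
  have hδSpos : 0 < δS := by positivity
  have hδS7 : δS ≤ δ7 := by rw [hδS]; linarith
  set δ : ℝ := min (min (min δ₁ δS) (min (κ₁ / (18 * (((3 : ℕ) : ℝ) + 1))) (δS * (Lc : ℝ) / (108 * (((3 : ℕ) : ℝ) + 1))))) (δ₃ / 3) with hδdef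
  have hδpos : 0 < δ := lt_min (lt_min (lt_min hδ₁ hδSpos) (lt_min (by positivity) (by positivity))) (by positivity)
  have hδ_δ₁ : δ ≤ δ₁ := (min_le_left _ _).trans ((min_le_left _ _).trans (min_le_left _ _))
  have hδ_δS : δ ≤ δS := (min_le_left _ _).trans ((min_le_left _ _).trans (min_le_right _ _))
  have hδ_κ₁ : 18 * (((3 : ℕ) : ℝ) + 1) * δ ≤ κ₁ :=
    mul_le_of_le_div' h18 ((min_le_left _ _).trans ((min_le_right _ _).trans (min_le_left _ _)))
  have hδ_gap : 108 * (((3 : ℕ) : ℝ) + 1) * δ ≤ δS * (Lc : ℝ) :=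
    mul_le_of_le_div' h108 ((min_le_left _ _).trans ((min_le_right _ _).trans (min_le_right _ _)))
  have hδ_δ₃ : δ ≤ δ₃ / 3 := min_le_right _ _
  set δD : ℝ := min δ (min (κΔ / (18 * (((3 : ℕ) : ℝ) + 1))) (δ * (Lc : ℝ) / (108 * (((3 : ℕ) : ℝ) + 1)))) with hδDdef
  have hδDpos : 0 < δD := lt_min hδpos (lt_min (by positivity) (by positivity))
  have hδD_δ : δD ≤ δ := min_le_left _ _
  have hδD_κΔ : 18 * (((3 : ℕ) : ℝ) + 1) * δD ≤ κΔ := mul_le_of_le_div' h18 ((min_le_right _ _).trans (min_le_left _ _))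
  have hδD_gap : 108 * (((3 : ℕ) : ℝ) + 1) * δD ≤ δ * (Lc : ℝ) := mul_le_of_le_div' h108 ((min_le_right _ _).trans (min_le_right _ _))
  have hδD_δ₁ : δD ≤ δ₁ := hδD_δ.trans hδ_δ₁
  have hδD_δS : δD ≤ δS := hδD_δ.trans hδ_δS
  have hδD_κ₁ : 18 * (((3 : ℕ) : ℝ) + 1) * δD ≤ κ₁ := (mul_le_mul_of_nonneg_left hδD_δ h18.le).trans hδ_κ₁
  have hδD_gapS : 108 * (((3 : ℕ) : ℝ) + 1) * δD ≤ δS * (Lc : ℝ) := (mul_le_mul_of_nonneg_left hδD_δ h108.le).trans hδ_gap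
  have hδD_δ₃ : δD ≤ δ₃ / 3 := hδD_δ.trans hδ_δ₃
  -- THE LENGTH
  obtain ⟨kmin, Hk⟩ := HW1' δ hδpos hδ_δ₁
  obtain ⟨kminD, HkD⟩ := HW1' δD hδDpos hδD_δ₁
  obtain ⟨θ, Cg, hθ0, hθ1, hCg, H1c⟩ := Hk (max kmin kminD) (le_max_left _ _)
  obtain ⟨θD, CgD, hθD0, hθD1, hCgD, H1Dc⟩ := HkD (max kmin kminD) (le_max_right _ _)
  have hk₀ : 0 < max kmin kminD + 1 := Nat.succ_pos _
  -- THE CONSTANTS (after the length)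
  obtain ⟨A, B, hA1, hB0, Hwc⟩ := HWs' δS δ hδpos hδ_δS hδ_κ₁ hδ_gap (max kmin kminD + 1)
  obtain ⟨AD, BD, hAD1, hBD0, HwDc⟩ := HWs' δS δD hδDpos hδD_δS hδD_κ₁ hδD_gapS (max kmin kminD + 1)
  obtain ⟨AΔ, BΔ, hAΔ, hBΔ, HΔc⟩ := HWΔ' δ δD hδDpos hδD_δ hδD_κΔ hδD_gap (max kmin kminD + 1)
  -- ONE geometric rate for the drift display
  set ν : ℝ := max νΔ (max θb ν₃) with hνdef
  have hν0 : 0 ≤ ν := hνΔ0.trans (le_max_left _ _)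
  have hν1 : ν < 1 := max_lt hνΔ1 (max_lt hθb1 hν₃1)
  have hpowΔ : ∀ l : ℕ, νΔ ^ l ≤ ν ^ l := fun l => pow_le_pow_left₀ hνΔ0 (le_max_left _ _) l
  have hpowF : ∀ l : ℕ, θb ^ l ≤ ν ^ l := fun l => pow_le_pow_left₀ hθb0 ((le_max_left _ _).trans (le_max_right _ _)) l
  have hpow₃ : ∀ l : ℕ, ν₃ ^ l ≤ ν ^ l := fun l => pow_le_pow_left₀ hν₃0 ((le_max_right _ _).trans (le_max_right _ _)) l
  -- the slaved constants are nonnegative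
  have hσ₁ : 0 ≤ σ₁ := (Hh₁ 0).nonneg
  have hσ₂ : 0 ≤ σ₂ := (Hh₂ 0).nonneg
  have hσ₁d : 0 ≤ σ₁d := by have h := (Hh₁d 0).nonneg; rwa [pow_zero, mul_one] at h
  have hσ₂d : 0 ≤ σ₂d := by have h := (Hh₂d 0).nonneg; rwa [pow_zero, mul_one] at h
  -- W2: the members and their drifts are in the ruled class (third conjunct = summability at some rate)
  have hmem := fun n => (halfMember_comb_legLetter_mem tabs cE cVH cΛ cE₂ cB Tc hε1 n).2.2
  have hmemd := fun n => (halfMember_comb_legDrift_mem tabs cE cVH cΛ cE₂ cB Tc hε1 n).2.2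
  -- the letter rows in W3's currencies (no smallness: `Γ₄`, `Γ₂` enter linearly)
  have dHS := fun n => (HS6 n).mono hδS7
  have dHSL := fun n => hΓ₄ _ CF (HS6 n)
  have dHx0 := Hx06.mono hδS7
  have dHxL0 := hΓ₄ _ C₀ Hx06
  have dH3 := fun n => windowRows_weaken le_rfl hδ_δ₃ (hΓ₂ _ σ₁ σ₂ (hmem n) (Hh₁ n) (Hh₂ n))
  have dHS' := fun l => locStencil₂_weaken (HS6' l) (mul_le_mul_of_nonneg_left (hpowF l) hcF) hδS7
  have dHSL' := fun l => windowRows_weaken (g' := Γ₄ * cF * ν ^ l)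
    (by rw [← mul_assoc]; exact mul_le_mul_of_nonneg_left (hpowF l) (mul_nonneg hΓ₄0 hcF)) le_rfl (hΓ₄ _ (cF * θb ^ l) (HS6' l))
  -- W3: the two (Q-L) rows at `δ` …
  have hLL := legRows_halfMember_comb_three_of_windows tabs cE cVH cΛ cE₂ cB Tc hBff hBmm hε
    (GoodL := fun (W : (Fin (3 + 1) → (Fin (3 + 1) → ℤ) → Fin (3 + 1) → (Fin (3 + 1) → ℤ) → MKer (3 + 1) (Fib 3))) (g : ℝ) =>
      (∀ (κ₁ : Fin (3 + 1)) (v : Site (3 + 1)) (κ₂ : Fin (3 + 1)) (x p : Site (3 + 1)) (f b : Fib 3),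
          |∑' v', W κ₁ v κ₂ v' x p f b| ≤ g * Real.exp (-δ * (l1 (x - v) + l1 (p - v)))) ∧
      (∀ (κ₁ κ₂ : Fin (3 + 1)) (v' x p : Site (3 + 1)) (f b : Fib 3),
          |∑' v, W κ₁ v κ₂ v' x p f b| ≤ g * Real.exp (-δ * (l1 (x - v') + l1 (p - v')))) ∧
      (∀ (κ₁ κ₂ : Fin (3 + 1)) (x p : Site (3 + 1)) (f b : Fib 3),
          |∑' v, ∑' v', W κ₁ v κ₂ v' x p f b| ≤ g * Real.exp (-δ * l1 (p - x))) ∧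
      (∀ (κ : Fin (3 + 1)) (v w x p : Site (3 + 1)) (f b : Fib 3),
          |∑ μ, (W κ v μ (w - unitVec μ) x p f b - W κ v μ w x p f b)|
            ≤ g * Real.exp (-δ * l1 (w - v)) * Real.exp (-δ * (l1 (x - v) + l1 (p - v)))) ∧
      (∀ (κ' : Fin (3 + 1)) (w v' x p : Site (3 + 1)) (f b : Fib 3),
          |∑ κ, (W κ (w - unitVec κ) κ' v' x p f b - W κ w κ' v' x p f b)|
            ≤ g * Real.exp (-δ * l1 (v' - w)) * Real.exp (-δ * (l1 (x - w) + l1 (p - w)))))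
    (GoodLS := fun (W : (Fin (3 + 1) → (Fin (3 + 1) → ℤ) → Fin (3 + 1) → (Fin (3 + 1) → ℤ) → MKer (3 + 1) (Fib 3))) (g : ℝ) =>
      (∀ (κ₁ : Fin (3 + 1)) (v : Site (3 + 1)) (κ₂ : Fin (3 + 1)) (x p : Site (3 + 1)) (f b : Fib 3),
          |∑' v', W κ₁ v κ₂ v' x p f b| ≤ g * Real.exp (-δS * (l1 (x - v) + l1 (p - v)))) ∧
      (∀ (κ₁ κ₂ : Fin (3 + 1)) (v' x p : Site (3 + 1)) (f b : Fib 3),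
          |∑' v, W κ₁ v κ₂ v' x p f b| ≤ g * Real.exp (-δS * (l1 (x - v') + l1 (p - v')))) ∧
      (∀ (κ₁ κ₂ : Fin (3 + 1)) (x p : Site (3 + 1)) (f b : Fib 3),
          |∑' v, ∑' v', W κ₁ v κ₂ v' x p f b| ≤ g * Real.exp (-δS * l1 (p - x))) ∧
      (∀ (κ : Fin (3 + 1)) (v w x p : Site (3 + 1)) (f b : Fib 3),
          |∑ μ, (W κ v μ (w - unitVec μ) x p f b - W κ v μ w x p f b)|
            ≤ g * Real.exp (-δS * l1 (w - v)) * Real.exp (-δS * (l1 (x - v) + l1 (p - v)))) ∧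
      (∀ (κ' : Fin (3 + 1)) (w v' x p : Site (3 + 1)) (f b : Fib 3),
          |∑ κ, (W κ (w - unitVec κ) κ' v' x p f b - W κ w κ' v' x p f b)|
            ≤ g * Real.exp (-δS * l1 (v' - w)) * Real.exp (-δS * (l1 (x - w) + l1 (p - w)))))
    δ δS hk₀ hθ0 hθ1 hCg (by linarith) hB0 hCF (mul_nonneg hΓ₄0 hCF) hC₀ (mul_nonneg hΓ₄0 hC₀) (mul_nonneg hΓ₂0 (add_nonneg hσ₁ hσ₂))
    (fun n W C g _ hbdd hW hL => H1c n W C g hbdd hW hL.1 hL.2.1 hL.2.2.1 hL.2.2.2.1 hL.2.2.2.2)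
    (fun p q W C g hq _ hbdd hW hL => Hwc p q W C g hq hbdd hW hL.1 hL.2.1 hL.2.2.1 hL.2.2.2.1 hL.2.2.2.2)
    dHS dHSL dHx0 dHxL0 dH3
  -- … and the two drift rows at `δD`
  obtain ⟨c', ϑ, hc', hϑ0, hϑ1, hD1, hD2⟩ := legDriftRows_halfMember_comb_three_of_windows tabs cE cVH cΛ cE₂ cB Tc hBff hBmm hε
    (GoodL := fun (W : (Fin (3 + 1) → (Fin (3 + 1) → ℤ) → Fin (3 + 1) → (Fin (3 + 1) → ℤ) → MKer (3 + 1) (Fib 3))) (g : ℝ) =>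
      (∀ (κ₁ : Fin (3 + 1)) (v : Site (3 + 1)) (κ₂ : Fin (3 + 1)) (x p : Site (3 + 1)) (f b : Fib 3),
          |∑' v', W κ₁ v κ₂ v' x p f b| ≤ g * Real.exp (-δ * (l1 (x - v) + l1 (p - v)))) ∧
      (∀ (κ₁ κ₂ : Fin (3 + 1)) (v' x p : Site (3 + 1)) (f b : Fib 3),
          |∑' v, W κ₁ v κ₂ v' x p f b| ≤ g * Real.exp (-δ * (l1 (x - v') + l1 (p - v')))) ∧
      (∀ (κ₁ κ₂ : Fin (3 + 1)) (x p : Site (3 + 1)) (f b : Fib 3),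
          |∑' v, ∑' v', W κ₁ v κ₂ v' x p f b| ≤ g * Real.exp (-δ * l1 (p - x))) ∧
      (∀ (κ : Fin (3 + 1)) (v w x p : Site (3 + 1)) (f b : Fib 3),
          |∑ μ, (W κ v μ (w - unitVec μ) x p f b - W κ v μ w x p f b)|
            ≤ g * Real.exp (-δ * l1 (w - v)) * Real.exp (-δ * (l1 (x - v) + l1 (p - v)))) ∧
      (∀ (κ' : Fin (3 + 1)) (w v' x p : Site (3 + 1)) (f b : Fib 3),
          |∑ κ, (W κ (w - unitVec κ) κ' v' x p f b - W κ w κ' v' x p f b)|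
            ≤ g * Real.exp (-δ * l1 (v' - w)) * Real.exp (-δ * (l1 (x - w) + l1 (p - w)))))
    (GoodLS := fun (W : (Fin (3 + 1) → (Fin (3 + 1) → ℤ) → Fin (3 + 1) → (Fin (3 + 1) → ℤ) → MKer (3 + 1) (Fib 3))) (g : ℝ) =>
      (∀ (κ₁ : Fin (3 + 1)) (v : Site (3 + 1)) (κ₂ : Fin (3 + 1)) (x p : Site (3 + 1)) (f b : Fib 3),
          |∑' v', W κ₁ v κ₂ v' x p f b| ≤ g * Real.exp (-δS * (l1 (x - v) + l1 (p - v)))) ∧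
      (∀ (κ₁ κ₂ : Fin (3 + 1)) (v' x p : Site (3 + 1)) (f b : Fib 3),
          |∑' v, W κ₁ v κ₂ v' x p f b| ≤ g * Real.exp (-δS * (l1 (x - v') + l1 (p - v')))) ∧
      (∀ (κ₁ κ₂ : Fin (3 + 1)) (x p : Site (3 + 1)) (f b : Fib 3),
          |∑' v, ∑' v', W κ₁ v κ₂ v' x p f b| ≤ g * Real.exp (-δS * l1 (p - x))) ∧
      (∀ (κ : Fin (3 + 1)) (v w x p : Site (3 + 1)) (f b : Fib 3),
          |∑ μ, (W κ v μ (w - unitVec μ) x p f b - W κ v μ w x p f b)|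
            ≤ g * Real.exp (-δS * l1 (w - v)) * Real.exp (-δS * (l1 (x - v) + l1 (p - v)))) ∧
      (∀ (κ' : Fin (3 + 1)) (w v' x p : Site (3 + 1)) (f b : Fib 3),
          |∑ κ, (W κ (w - unitVec κ) κ' v' x p f b - W κ w κ' v' x p f b)|
            ≤ g * Real.exp (-δS * l1 (v' - w)) * Real.exp (-δS * (l1 (x - w) + l1 (p - w)))))
    (GoodLD := fun (W : (Fin (3 + 1) → (Fin (3 + 1) → ℤ) → Fin (3 + 1) → (Fin (3 + 1) → ℤ) → MKer (3 + 1) (Fib 3))) (g : ℝ) =>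
      (∀ (κ₁ : Fin (3 + 1)) (v : Site (3 + 1)) (κ₂ : Fin (3 + 1)) (x p : Site (3 + 1)) (f b : Fib 3),
          |∑' v', W κ₁ v κ₂ v' x p f b| ≤ g * Real.exp (-δD * (l1 (x - v) + l1 (p - v)))) ∧
      (∀ (κ₁ κ₂ : Fin (3 + 1)) (v' x p : Site (3 + 1)) (f b : Fib 3),
          |∑' v, W κ₁ v κ₂ v' x p f b| ≤ g * Real.exp (-δD * (l1 (x - v') + l1 (p - v')))) ∧
      (∀ (κ₁ κ₂ : Fin (3 + 1)) (x p : Site (3 + 1)) (f b : Fib 3),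
          |∑' v, ∑' v', W κ₁ v κ₂ v' x p f b| ≤ g * Real.exp (-δD * l1 (p - x))) ∧
      (∀ (κ : Fin (3 + 1)) (v w x p : Site (3 + 1)) (f b : Fib 3),
          |∑ μ, (W κ v μ (w - unitVec μ) x p f b - W κ v μ w x p f b)|
            ≤ g * Real.exp (-δD * l1 (w - v)) * Real.exp (-δD * (l1 (x - v) + l1 (p - v)))) ∧
      (∀ (κ' : Fin (3 + 1)) (w v' x p : Site (3 + 1)) (f b : Fib 3),
          |∑ κ, (W κ (w - unitVec κ) κ' v' x p f b - W κ w κ' v' x p f b)|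
            ≤ g * Real.exp (-δD * l1 (v' - w)) * Real.exp (-δD * (l1 (x - w) + l1 (p - w)))))
    δ δS δD hk₀ hδD_δ hθ0 hθ1 hCg (by linarith) hB0 hCF (mul_nonneg hΓ₄0 hCF) hC₀ (mul_nonneg hΓ₄0 hC₀) (mul_nonneg hΓ₂0 (add_nonneg hσ₁ hσ₂))
    hθD0 hθD1 hCgD (by linarith) hBD0 hAΔ hBΔ hcF (mul_nonneg hΓ₄0 hcF) hν0 hν1 (mul_nonneg hΓ₂0 (add_nonneg hσ₁d hσ₂d))
    (fun n W C g _ hbdd hW hL => H1c n W C g hbdd hW hL.1 hL.2.1 hL.2.2.1 hL.2.2.2.1 hL.2.2.2.2)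
    (fun p q W C g hq _ hbdd hW hL => Hwc p q W C g hq hbdd hW hL.1 hL.2.1 hL.2.2.1 hL.2.2.2.1 hL.2.2.2.2)
    dHS dHSL dHx0 dHxL0 dH3
    (fun n W C g _ hbdd hW hL => H1Dc n W C g hbdd hW hL.1 hL.2.1 hL.2.2.1 hL.2.2.2.1 hL.2.2.2.2)
    (fun p q W C g hq _ hbdd hW hL => HwDc p q W C g hq hbdd hW hL.1 hL.2.1 hL.2.2.1 hL.2.2.2.1 hL.2.2.2.2)
    (fun l q W C g hq _ hbdd hW hL => by
      have h := HΔc l q W C g hq hbdd hW hL.1 hL.2.1 hL.2.2.1 hL.2.2.2.1 hL.2.2.2.2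
      have hC : 0 ≤ C := hW.nonneg
      have hg : 0 ≤ g := nonneg_of_abs_le_mul_exp hδpos.le (l1_nonneg _) (hL.2.2.1 0 0 0 0 (Sum.inl 0) (Sum.inl 0))
      exact locStencil₂_weaken h (mul_le_mul_of_nonneg_left (hpowΔ l) (by positivity)) le_rfl)
    dHS' dHSL'
    (fun n => by
      -- (H3d): the drifts' five rows from the slaved divergence-drift rows
      have hm := hmemd n
      rw [← rdiv_comp_sub] at hm
      have h := hΓ₂ _ (σ₁d * ν₃ ^ n) (σ₂d * ν₃ ^ n) hm (Hh₁d n) (Hh₂d n)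
      rw [rdiv_comp_sub] at h
      refine windowRows_weaken ?_ hδD_δ₃ h
      have e : Γ₂ * (σ₁d * ν₃ ^ n + σ₂d * ν₃ ^ n) = Γ₂ * (σ₁d + σ₂d) * ν₃ ^ n := by ring
      rw [e]; exact mul_le_mul_of_nonneg_left (hpow₃ n) (mul_nonneg hΓ₂0 (add_nonneg hσ₁d hσ₂d)))
  exact ⟨δD, _, c', ϑ, hδDpos, hc', hϑ0, hϑ1, fun l => (hLL.1 l).mono hδD_δ, fun l => (hLL.2 l).mono hδD_δ, hD1, hD2⟩

end Summit.QuantumFields.BalabanUV.Beta.GAN24.CombLegRowsOfNaturalWindows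

end
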